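/-
Origin: expansion seat `prover-pub-hodgecm-mc-binder-2-g14-0`, handover #R12 2026-08-20T11:00Z md5 3c8a6aa9afd5 (PKG 8c5327268208 → 3c8a6aa9afd5; 296 l.; (pv08 O1) six fourth arms: test element `P` at `sigmaSwap`, `kindTestWt .sigmaSwap := t₂t₁⁻¹`, `printLoc_ω_kindTestElt` via `ofPrintMCircleSwap_omega_P_pow`; `kindTestElt_of_ne_sigma` gains hyp `k ≠ .sigmaSwap` (0 users)) (`HOME/mc/pub-hodgecm-mc-binder-2/g14/t12/HodgeCM/Model/HypCensus/OmgOrient.lean`, md5 3c8a6aa9afd5, 296 lines);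
landed by the second packager p2 gen 7 (p2-g7) in gate run 50 REPLACES the earlier landed copy of `HodgeCM/Model/HypCensus/OmgOrient.lean` (seat copy carried the packager Origin header of an earlier run (stripped)).
-/
/-
Copyright (c) 2026. All rights reserved.
Released under Apache 2.0 license as described in the file LICENSE.
-/
import Summits.HodgeConjecture.HodgeCM.Model.HypCensus.SideWAssembly
import Summits.HodgeConjecture.HodgeCM.Model.HypCensus.OmgInsPinChoice
import Summits.HodgeConjecture.HodgeCM.Model.HypCensus.TorusDictionary

/-!
# (T12)-ORIENTATION in the kernel: the `∀ φ` torus junction forces the orientation of every `Σ₁₂` place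

Binder-2 lineage, rows 18/19 (and row 17, which consumes the same junction).  DIVERGENCE b2g11-1 and b2g14-1, b2g14-2 (memo
`mc/pub-hodgecm-mc-binder-2/g11/notes/T12-ORIENTATION.md`): E's hypothesis family `homg` (`HypSmoothSide.omg_ins` in its `∀ φ` form at the
census W pin) compares, at a `Σ₁₂` place `b`, the PRINTED torus scaling `f(z,w) ↦ f(t₁ z, t₂⁻¹ w)` (pv12 `LocalFock.ofPrintMCircle`, `(t₁,t₂)`
the `(W₁,W₂)`-coordinates) with the Weil letter, which scales the inserted pairing `P` by `t_{r₀} t̄_{s₀}` (`r₀` = the POSITIVE line at `b`;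
`V`-positive reading) resp. `t_{s₀} t̄_{r₀}` (negative reading).  This leaf proves the NECESSITY direction in the kernel:

* (T12 v2, RULING S5 (B1): every kind-indexed family below carries the fourth arm `sigmaSwap` — test element `P`,
  weight `t₂ t₁⁻¹`.)
* §1 block level: the negative-reading twins of #14 (`linSubst_star_dualPairι_torusLetter_X_QS/_X_QR`, `…_rename_neg`), and the test element
  `kindTestElt` (`P` at a `Σ₁₂` kind, the vacuum elsewhere) with its printed torus weight;
* §2 place level: the torus letter of the pin at a `Σ₁₂` place IS `torusLetter (c_{r₀}, c_{s₀})`; the eigen-equation of the inserted test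
  element in both `V`-readings;
* the assembly **`orient_of_homg`** (if `homg` holds at the pin for a test function `f` not killing `φ₀` and `φ_P`, then at every
  `Σ₁₂` place `b ≠ v₁`: `(0 < x_W(b) 0) ↔ (V reads positive at b)`, i.e. `ε_b = +1`) is the follow-up leaf `OmgOrientNecessity`.

§1's `…_rename_neg` is also the `sigmaNeg` twin of #14 wanted by RULING SUPPLEMENT 5 (B1) (STATUS l.13077) for the orientation-aware
`omg_ins` theorem.  Nothing here is a claim of PerL/QW8; it is a kernel statement about the typed census objects.
-/

set_option autoImplicit false

noncomputable section

open Filter Topology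
open NumberField NumberField.InfinitePlace
open scoped TensorProduct Classical ComplexConjugate
open MvPolynomial
open Literature.NumberTheory.Automorphic Literature.NumberTheory.Automorphic.UnitaryGroup Literature.NumberTheory.Weil1964
open Literature.RepresentationTheory.KonnoKonno2007 Literature.RepresentationTheory.KonnoKonno2007.RealDualPair
open Literature.NumberTheory.GelbartRogawski1991 Literature.NumberTheory.GelbartRogawski1991.UnitaryDualPair
open Literature.Analysis.SegalBargmann
open HodgeCM HodgeCM.Model HodgeCM.Adelic
open HodgeCM.PerL34.Fock HodgeCM.PerL34.Fock.PrintDict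
open NumberField.SeesawArchTorus

namespace HodgeCM.Model.HypCensus

/-! ## §1 Block level: the negative-reading torus dictionary; the test element of each kind -/

section NegTorusDict

variable {P' Q' R' S' : Type} [Fintype P'] [DecidableEq P'] [Fintype Q'] [DecidableEq Q'] [Fintype R'] [DecidableEq R']
  [Fintype S'] [DecidableEq S']
variable (eA : Fin 3 ≃ Q') (r₀ : R') (s₀ : S')

/-- same-sign block `Q × S`: `X_{(q,s)} ↦ t₂ X_{(q,s)}`. -/
theorem linSubst_star_dualPairι_torusLetter_X_QS (t : Circle × Circle) (q : Q') (s : S') :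
    linSubst (star ((dualPairι (torusLetter (P' := P') Q' t) : Matrix.unitaryGroup (DPIdx P' Q' R' S') ℂ) :
        Matrix (DPIdx P' Q' R' S') (DPIdx P' Q' R' S') ℂ)) (X (Sum.inl (Sum.inr (q, s)))) =
      C (t.2 : ℂ) * X (Sum.inl (Sum.inr (q, s))) := by
  rw [linSubst_X, torusLetter, coe_dualPairι]
  simp only [Fintype.sum_sum_type, Fintype.sum_prod_type, Matrix.star_apply, Matrix.fromBlocks_apply₁₁,
    Matrix.fromBlocks_apply₂₁, Matrix.fromBlocks_apply₁₂, Matrix.fromBlocks_apply₂₂, Matrix.map_apply, Matrix.kroneckerMap_apply,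
    star_star, Matrix.zero_apply, star_zero, coe_circleScalarUnitary, Matrix.smul_apply,
    Matrix.one_apply, smul_eq_mul, mul_ite, mul_one, mul_zero]
  simp only [OneMemClass.coe_one, Matrix.one_apply, ite_mul, one_mul, zero_mul, apply_ite C, map_zero,
    Finset.sum_ite_eq', Finset.mem_univ, if_true, Finset.sum_const_zero, add_zero, zero_add]

/-- mixed block `Q × R`: `X_{(q,r)} ↦ conj(t₁) X_{(q,r)}`. -/
theorem linSubst_star_dualPairι_torusLetter_X_QR (t : Circle × Circle) (q : Q') (r : R') :
    linSubst (star ((dualPairι (torusLetter (P' := P') Q' t) : Matrix.unitaryGroup (DPIdx P' Q' R' S') ℂ) :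
        Matrix (DPIdx P' Q' R' S') (DPIdx P' Q' R' S') ℂ)) (X (Sum.inr (Sum.inr (q, r)))) =
      C (conj (t.1 : ℂ)) * X (Sum.inr (Sum.inr (q, r))) := by
  rw [linSubst_X, torusLetter, coe_dualPairι]
  simp only [Fintype.sum_sum_type, Fintype.sum_prod_type, Matrix.star_apply, Matrix.fromBlocks_apply₁₂,
    Matrix.fromBlocks_apply₂₂, Matrix.kroneckerMap_apply,
    Matrix.zero_apply, star_zero, coe_circleScalarUnitary,
    Matrix.smul_apply, Matrix.one_apply, smul_eq_mul, mul_ite, mul_one, mul_zero]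
  simp only [OneMemClass.coe_one, Matrix.one_apply, ite_mul, one_mul, zero_mul, apply_ite C, apply_ite star, star_zero,
    map_zero, Finset.sum_ite_eq', Finset.mem_univ, if_true, Finset.sum_const_zero, zero_add, add_zero, Complex.star_def]

/-- **TORUS DICTIONARY, NEGATIVE `V`-READING** (variables `z_a ↦ (q_a, s₀)`, `w_a ↦ (q_a, r₀)`): the letter `k_t` scales by
`scalePi (t₂, t₁)` — the printed scaling with the two `W`-coordinates SWAPPED. -/
theorem linSubst_star_dualPairι_torusLetter_rename_neg (t : Circle × Circle) (F : HodgeCM.PerL34.Fock.MixedModel) :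
    linSubst (star ((dualPairι (torusLetter (P' := P') Q' t) : Matrix.unitaryGroup (DPIdx P' Q' R' S') ℂ) :
        Matrix (DPIdx P' Q' R' S') (DPIdx P' Q' R' S') ℂ)) (rename (mixedToDPIdxNeg P' eA r₀ s₀) F) =
      rename (mixedToDPIdxNeg P' eA r₀ s₀) (scalePi (circleUnits (t.2, t.1)) F) := by
  suffices h : (linSubst (star ((dualPairι (torusLetter (P' := P') Q' t) : Matrix.unitaryGroup (DPIdx P' Q' R' S') ℂ) :
        Matrix (DPIdx P' Q' R' S') (DPIdx P' Q' R' S') ℂ))).comp (rename (mixedToDPIdxNeg P' eA r₀ s₀)) =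
      (rename (mixedToDPIdxNeg P' eA r₀ s₀)).comp (scalePi (circleUnits (t.2, t.1))) from
    AlgHom.congr_fun h F
  refine MvPolynomial.algHom_ext fun v => ?_
  rcases v with a | a
  · rw [AlgHom.comp_apply, AlgHom.comp_apply, rename_X, mixedToDPIdxNeg_inl, linSubst_star_dualPairι_torusLetter_X_QS,
      scalePi_X, scaleWt_inl, map_smul, rename_X, mixedToDPIdxNeg_inl, circleUnits_fst_coe, smul_eq_C_mul]
  · rw [AlgHom.comp_apply, AlgHom.comp_apply, rename_X, mixedToDPIdxNeg_inr, linSubst_star_dualPairι_torusLetter_X_QR,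
      scalePi_X, scaleWt_inr, map_smul, rename_X, mixedToDPIdxNeg_inr, smul_eq_C_mul]
    congr 2
    rw [← Circle.coe_inv_eq_conj]
    rfl

end NegTorusDict

section TestElt

variable (lam : ℂ) (hlam : lam ≠ 0) (vac : Circle × Circle →* Circle)

/-- **the test element of each kind**: the pairing `P` at a `Σ₁₂` kind, the printed vacuum at the other kinds. -/
def kindTestElt : (k : PlaceKind) → (printLoc lam hlam vac k).M
  | .sigma => (⟨HodgeCM.PerL34.Fock.P ^ 1, P_pow_mem_kappaPartM 1⟩ : ↥kappaPartM)
  | .delta => (printLoc lam hlam vac .delta).φ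
  | .iota => (printLoc lam hlam vac .iota).φ
  | .sigmaSwap => (⟨HodgeCM.PerL34.Fock.P ^ 1, P_pow_mem_kappaPartM 1⟩ : ↥kappaPartM)

/-- the test polynomial of each kind. -/
def kindTestPoly : (k : PlaceKind) → MvPolynomial (KindVar k) ℂ
  | .sigma => HodgeCM.PerL34.Fock.P ^ 1
  | .delta => kindVacPoly .delta
  | .iota => kindVacPoly .iota
  | .sigmaSwap => HodgeCM.PerL34.Fock.P ^ 1

/-- (Ported verbatim from the HodgeCMPerL package; no docstring in the source.) -/
theorem kindIncl_kindTestElt : ∀ k : PlaceKind, kindIncl lam hlam vac k (kindTestElt lam hlam vac k) = kindTestPoly k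
  | .sigma => rfl
  | .delta => kindIncl_φ lam hlam vac .delta
  | .iota => kindIncl_φ lam hlam vac .iota
  | .sigmaSwap => rfl

/-- (Ported verbatim from the HodgeCMPerL package; no docstring in the source.) -/
theorem kindTestElt_of_ne_sigma : ∀ {k : PlaceKind}, k ≠ .sigma → k ≠ .sigmaSwap →
    kindTestElt lam hlam vac k = (printLoc lam hlam vac k).φ
  | .sigma, h, _ => absurd rfl h
  | .delta, _, _ => rfl
  | .iota, _, _ => rfl
  | .sigmaSwap, _, h => absurd rfl h

/-- the extra printed torus weight of the test element: `t₁ t₂⁻¹` at a `Σ₁₂` kind, `t₂ t₁⁻¹` at a swapped `Σ₁₂` kind (T12),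
`1` elsewhere. -/
def kindTestWt : PlaceKind → Circle × Circle → ℂ
  | .sigma => fun t => (t.1 : ℂ) * ((t.2 : ℂ))⁻¹
  | .delta => fun _ => 1
  | .iota => fun _ => 1
  | .sigmaSwap => fun t => (t.2 : ℂ) * ((t.1 : ℂ))⁻¹

/-- **the printed torus on the test element**: `ω t x = (χ t · kindTestWt t) • x` (pv12 `ofPrintMCircle_omega_P_pow` at `k = 1`; the
vacuum eigen-equation at the other kinds). -/
theorem printLoc_ω_kindTestElt : ∀ (k : PlaceKind) (t : (printLoc lam hlam vac k).T),
    (printLoc lam hlam vac k).ω t (kindTestElt lam hlam vac k) =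
      ((printLoc lam hlam vac k).χ t * kindTestWt k (kindCoord lam hlam vac k t)) • kindTestElt lam hlam vac k
  | .sigma, t => by
    apply Subtype.ext
    change (((((fun s => ((vac s : Circle) : ℂ)) t) • (scalePi (circleUnits t)).toLinearMap.restrict (scalePi_mem_kappaPartM (circleUnits t)))
        ⟨HodgeCM.PerL34.Fock.P ^ 1, P_pow_mem_kappaPartM 1⟩ : ↥kappaPartM) : MixedModel) = _
    rw [LocalFock.ofPrintMCircle_omega_P_pow (fun s => ((vac s : Circle) : ℂ)) t 1, pow_one]
    rfl
  | .delta, t => by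
    rw [kindTestElt, (printLoc lam hlam vac .delta).eigen, kindTestWt, mul_one]
  | .iota, t => by
    rw [kindTestElt, (printLoc lam hlam vac .iota).eigen, kindTestWt, mul_one]
  | .sigmaSwap, t => by
    apply Subtype.ext
    change (((((fun s => ((vac s : Circle) : ℂ)) t) • (scalePi (circleUnits t.swap)).toLinearMap.restrict
        (scalePi_mem_kappaPartM (circleUnits t.swap))) ⟨HodgeCM.PerL34.Fock.P ^ 1, P_pow_mem_kappaPartM 1⟩ : ↥kappaPartM) : MixedModel) = _
    rw [LocalFock.ofPrintMCircleSwap_omega_P_pow (fun s => ((vac s : Circle) : ℂ)) t 1, pow_one]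
    rfl

end TestElt


/-! ## §2 Place level: the torus letter at a `Σ₁₂` place; the eigen-equation of the inserted test element -/

section Place

variable (L : Type) [Field L] [NumberField L] [IsCMField L]
variable (dV : Fin 3 → L) (hdV : ∀ i, IsCMField.complexConj L (dV i) = dV i)
variable (dW : Fin 2 → L) (hdW : ∀ i, IsCMField.complexConj L (dW i) = dW i) (ι₁ : L →+* ℂ)

/-- **at a `Σ₁₂` place the torus letter of the pin IS `torusLetter (c_{r₀}, c_{s₀})`** (both `W`-blocks are points). -/
theorem torusPlaceLetter_eq_torusLetter (v : {v : InfinitePlace ↥(maximalRealSubfield L) // v.IsReal})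
    (r₀ : PosIdx (cmXW L dV dW hdW ι₁ v)) (s₀ : NegIdx (cmXW L dV dW hdW ι₁ v))
    (hR : Subsingleton (PosIdx (cmXW L dV dW hdW ι₁ v))) (hS : Subsingleton (NegIdx (cmXW L dV dW hdW ι₁ v))) (u : SeesawArchTorus L) :
    torusPlaceLetter L dV hdV dW hdW ι₁ v u =
      torusLetter (P' := PosIdx (cmXV L dV hdV ι₁ v)) (R' := PosIdx (cmXW L dV dW hdW ι₁ v)) (S' := NegIdx (cmXW L dV dW hdW ι₁ v))
        (NegIdx (cmXV L dV hdV ι₁ v)) (torusPlaceCircles L v u r₀.1, torusPlaceCircles L v u s₀.1) := by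
  refine Prod.ext (torusPlaceLetter_fst L dV hdV dW hdW ι₁ v u) (Prod.ext ?_ ?_)
  · apply Subtype.ext
    rw [torusPlaceLetter_snd]
    rw [coe_diagHom]
    change _ = ((circleScalarUnitary (PosIdx (cmXW L dV dW hdW ι₁ v)) (torusPlaceCircles L v u r₀.1) :
      Matrix.unitaryGroup (PosIdx (cmXW L dV dW hdW ι₁ v)) ℂ) : Matrix (PosIdx (cmXW L dV dW hdW ι₁ v)) (PosIdx (cmXW L dV dW hdW ι₁ v)) ℂ)
    rw [coe_circleScalarUnitary]
    ext i j
    obtain rfl : i = r₀ := Subsingleton.elim _ _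
    obtain rfl : j = i := Subsingleton.elim _ _
    rw [Matrix.diagonal_apply_eq, Matrix.smul_apply, Matrix.one_apply_eq, smul_eq_mul, mul_one, circleRestrict_apply]
  · apply Subtype.ext
    rw [torusPlaceLetter_snd]
    rw [coe_diagHom]
    change _ = ((circleScalarUnitary (NegIdx (cmXW L dV dW hdW ι₁ v)) (torusPlaceCircles L v u s₀.1) :
      Matrix.unitaryGroup (NegIdx (cmXW L dV dW hdW ι₁ v)) ℂ) : Matrix (NegIdx (cmXW L dV dW hdW ι₁ v)) (NegIdx (cmXW L dV dW hdW ι₁ v)) ℂ)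
    rw [coe_circleScalarUnitary]
    ext i j
    obtain rfl : i = s₀ := Subsingleton.elim _ _
    obtain rfl : j = i := Subsingleton.elim _ _
    rw [Matrix.diagonal_apply_eq, Matrix.smul_apply, Matrix.one_apply_eq, smul_eq_mul, mul_one, circleRestrict_apply]

variable (datum : ∀ b : InfinitePlace L, PlaceDatum L dV hdV dW hdW ι₁ (cmPlacesEquiv L b)) (m₁ m₂ : InfinitePlace L → ℤ)

/-- **the test element of the census at the place `b`**: the printed pairing `P` if `b` is of kind `Σ₁₂`, the printed vacuum otherwise. -/
abbrev testElt (b : InfinitePlace L) :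
    ((printPlaces (InfinitePlace L) (kindOf L dV hdV dW hdW ι₁ datum) (lamOf L dV hdV dW hdW ι₁ datum)
      (lamOf_ne_zero L dV hdV dW hdW ι₁ datum) (pinnedVacs (kindOf L dV hdV dW hdW ι₁ datum) m₁ m₂)).loc b).M :=
  kindTestElt (lamOf L dV hdV dW hdW ι₁ datum b) (lamOf_ne_zero L dV hdV dW hdW ι₁ datum b)
    (pinnedVacs (kindOf L dV hdV dW hdW ι₁ datum) m₁ m₂ b) (kindOf L dV hdV dW hdW ι₁ datum b)

/-- the embedded test element is the renamed test polynomial of the place's kind. -/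
theorem embOf_testElt (b : InfinitePlace L) :
    embOf L dV hdV dW hdW ι₁ datum m₁ m₂ b (testElt L dV hdV dW hdW ι₁ datum m₁ m₂ b) = rename (datum b).idx (kindTestPoly (datum b).kind) :=
  congrArg (rename (datum b).idx) (kindIncl_kindTestElt _ _ _ _)

/-- **THE TORUS LETTER ON THE EMBEDDED TEST ELEMENT AT A `Σ₁₂` PLACE READ POSITIVE**: eigenvalue `c_{r₀} · c_{s₀}⁻¹`. -/
theorem linSubst_torusLetter_embOf_testElt_of_eq_sigmaPos (b : InfinitePlace L)
    (eA : Fin 3 ≃ PosIdx (cmXV L dV hdV ι₁ (cmPlacesEquiv L b))) (hQ : IsEmpty (NegIdx (cmXV L dV hdV ι₁ (cmPlacesEquiv L b))))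
    (r₀ : PosIdx (cmXW L dV dW hdW ι₁ (cmPlacesEquiv L b))) (s₀ : NegIdx (cmXW L dV dW hdW ι₁ (cmPlacesEquiv L b)))
    (hR : Subsingleton (PosIdx (cmXW L dV dW hdW ι₁ (cmPlacesEquiv L b)))) (hS : Subsingleton (NegIdx (cmXW L dV dW hdW ι₁ (cmPlacesEquiv L b))))
    (hσ : datum b = PlaceDatum.sigmaPos eA hQ r₀ s₀ hR hS) (u : SeesawArchTorus L) :
    linSubst (star ((reindexUnitary (pairFrame (PosIdx (cmXV L dV hdV ι₁ (cmPlacesEquiv L b))) (NegIdx (cmXV L dV hdV ι₁ (cmPlacesEquiv L b)))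
        (PosIdx (cmXW L dV dW hdW ι₁ (cmPlacesEquiv L b))) (NegIdx (cmXW L dV dW hdW ι₁ (cmPlacesEquiv L b))) finProdFinEquiv
        (cmEpsV L dV hdV ι₁ (cmPlacesEquiv L b)) (cmEpsW L dV dW hdW ι₁ (cmPlacesEquiv L b)))
        (dualPairι (torusPlaceLetter L dV hdV dW hdW ι₁ (cmPlacesEquiv L b) u)) : Matrix.unitaryGroup (Fin 6) ℂ) : Matrix (Fin 6) (Fin 6) ℂ))
        (embOf L dV hdV dW hdW ι₁ datum m₁ m₂ b (testElt L dV hdV dW hdW ι₁ datum m₁ m₂ b)) =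
      (((torusPlaceCircles L (cmPlacesEquiv L b) u r₀.1 : Circle) : ℂ) * (((torusPlaceCircles L (cmPlacesEquiv L b) u s₀.1 : Circle) : ℂ))⁻¹) •
        embOf L dV hdV dW hdW ι₁ datum m₁ m₂ b (testElt L dV hdV dW hdW ι₁ datum m₁ m₂ b) := by
  have hidx : ((PlaceDatum.sigmaPos eA hQ r₀ s₀ hR hS : PlaceDatum L dV hdV dW hdW ι₁ (cmPlacesEquiv L b)).idx :
      HodgeCM.PerL34.Fock.MixedVar → Fin 6) =
      (pairFrame (PosIdx (cmXV L dV hdV ι₁ (cmPlacesEquiv L b))) (NegIdx (cmXV L dV hdV ι₁ (cmPlacesEquiv L b)))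
        (PosIdx (cmXW L dV dW hdW ι₁ (cmPlacesEquiv L b))) (NegIdx (cmXW L dV dW hdW ι₁ (cmPlacesEquiv L b))) finProdFinEquiv
        (cmEpsV L dV hdV ι₁ (cmPlacesEquiv L b)) (cmEpsW L dV dW hdW ι₁ (cmPlacesEquiv L b))).symm ∘
        mixedToDPIdx (NegIdx (cmXV L dV hdV ι₁ (cmPlacesEquiv L b))) eA r₀ s₀ := by
    funext x
    change (cmIdx L dV hdV dW hdW ι₁ (cmPlacesEquiv L b)).symm (mixedToDPIdx _ eA r₀ s₀ x) = _
    rw [cmIdx_eq_pairFrame]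
    rfl
  have hre : embOf L dV hdV dW hdW ι₁ datum m₁ m₂ b (testElt L dV hdV dW hdW ι₁ datum m₁ m₂ b) =
      rename (pairFrame (PosIdx (cmXV L dV hdV ι₁ (cmPlacesEquiv L b))) (NegIdx (cmXV L dV hdV ι₁ (cmPlacesEquiv L b)))
        (PosIdx (cmXW L dV dW hdW ι₁ (cmPlacesEquiv L b))) (NegIdx (cmXW L dV dW hdW ι₁ (cmPlacesEquiv L b))) finProdFinEquiv
        (cmEpsV L dV hdV ι₁ (cmPlacesEquiv L b)) (cmEpsW L dV dW hdW ι₁ (cmPlacesEquiv L b))).symm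
        (rename (mixedToDPIdx (NegIdx (cmXV L dV hdV ι₁ (cmPlacesEquiv L b))) eA r₀ s₀) (HodgeCM.PerL34.Fock.P ^ 1)) := by
    rw [embOf_testElt, hσ, rename_rename]
    exact congrArg (fun j => rename j (HodgeCM.PerL34.Fock.P ^ 1)) hidx
  rw [hre, linSubst_star_reindexUnitary_rename, torusPlaceLetter_eq_torusLetter L dV hdV dW hdW ι₁ _ r₀ s₀ hR hS,
    linSubst_star_dualPairι_torusLetter_rename, scalePi_P_pow, map_smul, map_smul, pow_one, Units.val_inv_eq_inv_val,
    circleUnits_fst_coe, circleUnits_snd_coe]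

/-- **THE TORUS LETTER ON THE EMBEDDED TEST ELEMENT AT A `Σ₁₂` PLACE READ NEGATIVE**: eigenvalue `c_{s₀} · c_{r₀}⁻¹`. -/
theorem linSubst_torusLetter_embOf_testElt_of_eq_sigmaNeg (b : InfinitePlace L)
    (eA : Fin 3 ≃ NegIdx (cmXV L dV hdV ι₁ (cmPlacesEquiv L b))) (hP0 : IsEmpty (PosIdx (cmXV L dV hdV ι₁ (cmPlacesEquiv L b))))
    (r₀ : PosIdx (cmXW L dV dW hdW ι₁ (cmPlacesEquiv L b))) (s₀ : NegIdx (cmXW L dV dW hdW ι₁ (cmPlacesEquiv L b)))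
    (hR : Subsingleton (PosIdx (cmXW L dV dW hdW ι₁ (cmPlacesEquiv L b)))) (hS : Subsingleton (NegIdx (cmXW L dV dW hdW ι₁ (cmPlacesEquiv L b))))
    (hσ : datum b = PlaceDatum.sigmaNeg eA hP0 r₀ s₀ hR hS) (u : SeesawArchTorus L) :
    linSubst (star ((reindexUnitary (pairFrame (PosIdx (cmXV L dV hdV ι₁ (cmPlacesEquiv L b))) (NegIdx (cmXV L dV hdV ι₁ (cmPlacesEquiv L b)))
        (PosIdx (cmXW L dV dW hdW ι₁ (cmPlacesEquiv L b))) (NegIdx (cmXW L dV dW hdW ι₁ (cmPlacesEquiv L b))) finProdFinEquiv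
        (cmEpsV L dV hdV ι₁ (cmPlacesEquiv L b)) (cmEpsW L dV dW hdW ι₁ (cmPlacesEquiv L b)))
        (dualPairι (torusPlaceLetter L dV hdV dW hdW ι₁ (cmPlacesEquiv L b) u)) : Matrix.unitaryGroup (Fin 6) ℂ) : Matrix (Fin 6) (Fin 6) ℂ))
        (embOf L dV hdV dW hdW ι₁ datum m₁ m₂ b (testElt L dV hdV dW hdW ι₁ datum m₁ m₂ b)) =
      (((torusPlaceCircles L (cmPlacesEquiv L b) u s₀.1 : Circle) : ℂ) * (((torusPlaceCircles L (cmPlacesEquiv L b) u r₀.1 : Circle) : ℂ))⁻¹) •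
        embOf L dV hdV dW hdW ι₁ datum m₁ m₂ b (testElt L dV hdV dW hdW ι₁ datum m₁ m₂ b) := by
  have hidx : ((PlaceDatum.sigmaNeg eA hP0 r₀ s₀ hR hS : PlaceDatum L dV hdV dW hdW ι₁ (cmPlacesEquiv L b)).idx :
      HodgeCM.PerL34.Fock.MixedVar → Fin 6) =
      (pairFrame (PosIdx (cmXV L dV hdV ι₁ (cmPlacesEquiv L b))) (NegIdx (cmXV L dV hdV ι₁ (cmPlacesEquiv L b)))
        (PosIdx (cmXW L dV dW hdW ι₁ (cmPlacesEquiv L b))) (NegIdx (cmXW L dV dW hdW ι₁ (cmPlacesEquiv L b))) finProdFinEquiv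
        (cmEpsV L dV hdV ι₁ (cmPlacesEquiv L b)) (cmEpsW L dV dW hdW ι₁ (cmPlacesEquiv L b))).symm ∘
        mixedToDPIdxNeg (PosIdx (cmXV L dV hdV ι₁ (cmPlacesEquiv L b))) eA r₀ s₀ := by
    funext x
    change (cmIdx L dV hdV dW hdW ι₁ (cmPlacesEquiv L b)).symm (mixedToDPIdxNeg _ eA r₀ s₀ x) = _
    rw [cmIdx_eq_pairFrame]
    rfl
  have hre : embOf L dV hdV dW hdW ι₁ datum m₁ m₂ b (testElt L dV hdV dW hdW ι₁ datum m₁ m₂ b) =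
      rename (pairFrame (PosIdx (cmXV L dV hdV ι₁ (cmPlacesEquiv L b))) (NegIdx (cmXV L dV hdV ι₁ (cmPlacesEquiv L b)))
        (PosIdx (cmXW L dV dW hdW ι₁ (cmPlacesEquiv L b))) (NegIdx (cmXW L dV dW hdW ι₁ (cmPlacesEquiv L b))) finProdFinEquiv
        (cmEpsV L dV hdV ι₁ (cmPlacesEquiv L b)) (cmEpsW L dV dW hdW ι₁ (cmPlacesEquiv L b))).symm
        (rename (mixedToDPIdxNeg (PosIdx (cmXV L dV hdV ι₁ (cmPlacesEquiv L b))) eA r₀ s₀) (HodgeCM.PerL34.Fock.P ^ 1)) := by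
    rw [embOf_testElt, hσ, rename_rename]
    exact congrArg (fun j => rename j (HodgeCM.PerL34.Fock.P ^ 1)) hidx
  rw [hre, linSubst_star_reindexUnitary_rename, torusPlaceLetter_eq_torusLetter L dV hdV dW hdW ι₁ _ r₀ s₀ hR hS,
    linSubst_star_dualPairι_torusLetter_rename_neg, scalePi_P_pow, map_smul, map_smul, pow_one, Units.val_inv_eq_inv_val,
    circleUnits_fst_coe, circleUnits_snd_coe]

end Place

end HodgeCM.Model.HypCensus

end
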